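import Summits.FinalStateConjecture.FinalStateConjecture.Theorems.ZeroEnergyKerrOrBombErgoregionBombModTLightPointTransport
import Literature.Geometry.Lorentzian.CausalityOpennessProofs
import Literature.Geometry.Lorentzian.CompleteStationaryVacuumFlatProofs
import Literature.Topology.FourManifolds.MorseExtrema

/-!
# `ErgoregionBombModT` — the evanescent species: a telescope hole WITHOUT ergoregion but with one
# null point of `T` in its d.o.c. inhabits the antecedent (crux stmt-FinalStateConjecture-17838, lead c3)

Route `ZeroEnergyKerrOrBomb` of the Final State Conjecture, crux
`Summit.FinalStateConjecture.FinalStateConjecture.Theses.ZeroEnergyKerrOrBomb.ErgoregionBombModT`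
(the ergoregion bomb modulo the stationary flow), line `killing-light-points`, skeleton v4: the
crux is, losslessly, `OffWallBomb ∧ LightPointBomb` (p139708), where `LightPointBomb` asks an
exponentially growing Killing-mode pair of every telescope hole carrying a Killing light point
(`p ∈ ⟨⟨M_ext⟩⟩`, `g(T,T)(p) = 0`, `∇_T T = κ T` at `p`).  This file isolates the sub-species of
`LightPointBomb` on which the bomb heuristics fail outright — the **evanescent** light points — and
certifies that they inhabit the antecedent:

* `leviCivita_killing_self_eq_zero_of_mfderiv_eq_zero` — a critical point of `g(T,T)` is a
  HOVERING light point (`∇_T T = 0`): the Killing identity `2 g(Y, ∇_T T) = -Y g(T,T)`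
  (`IsKillingField.two_mul_val_leviCivita_self_apply_self`, O'Neill 1983 Ch. 9 Prop. 9.25) and
  non-degeneracy of `g_p`;
* `leviCivita_killing_self_eq_zero_of_isLocalMax` — in particular every local maximum of `g(T,T)`
  (Fermat on a manifold without boundary, `IsLocalMax.isMCriticalPt`);
* `leviCivita_killing_self_eq_zero_of_causal_of_null` — hence on a hole whose stationary field is
  CAUSAL on the whole domain of outer communications (`g(T,T) ≤ 0` on `⟨⟨M_ext⟩⟩`: no ergoregion at
  all) every point of `⟨⟨M_ext⟩⟩` where `T` is null is a hovering light point (the d.o.c. is open: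
  `StationaryAFBlackHole.isOpen_doc` with the discharged openness facts of `I±`);
* `hasZeroEnergyRayTrappedModFlow_of_causal_of_null` — and therefore such a hole carries a maximal
  zero-energy null geodesic trapped modulo the flow (`hasZeroEnergyRayTrappedModFlow_of_hoveringLightPoint`,
  p138761): the `T`-orbit through the null point — an "evanescent ergosurface" in the sense of
  Eperon–Reall–Santos 2016 / Keir 2018, where in the horizonless non-vacuum analogue linear waves
  stay uniformly bounded and decay only logarithmically, with NO growing mode;
* `ergoregionFreeNullPoint_inhabits_antecedent` — the same in closed `∀`-form (registered
  certificate of the crux item);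
* `bomb_of_causal_of_null_of_lightPointBomb` — consequently `LightPointBomb` (the registered stub
  `stub_lightPointBomb`, body VERBATIM as hypothesis), and with it the crux, assert that **every
  telescope hole without ergoregion whose stationary field is null somewhere in the d.o.c. carries an
  exponentially growing smooth Killing mode** — although for `T` causal on `⟨⟨M_ext⟩⟩` the `T`-energy
  of `□ψ = 0` is non-negative and non-increasing (horizon and null infinity only absorb), which is the
  textbook obstruction to any finite-energy growing mode (Kay–Wald; Dafermos–Rodnianski 2008 §7).
  For the planners: this is the sharpest form of "`LightPointBomb` is the suspicious half" — the
  crux as typed is true on the evanescent species only if that species is EMPTY (a uniqueness-type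
  statement: `T` causal on the d.o.c. of a telescope hole ⇒ `T` timelike there), so a restate
  should either add the off-wall clause (crux := `OffWallBomb`) or exclude light points / demand
  `g(T,T) > 0` somewhere on the trapped set.

References: B. O'Neill, *Semi-Riemannian geometry* (1983), Ch. 9 Prop. 9.25; J. Milnor, *Morse
theory* (1963), §2; F. C. Eperon, H. S. Reall, J. E. Santos, JHEP 10 (2016) 031 (arXiv:1607.06828);
J. Keir, Class. Quantum Grav. 37 (2020) (arXiv:1609.01733), arXiv:1810.03026; M. Dafermos,
I. Rodnianski, arXiv:0811.0354, §7; crux workfiles `Cruxes/ErgoregionBombModT/Lines/killing_light_points.lean`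
(skeleton v4), `Cruxes/ErgoregionBombModT/Disproof.lean` §7.
-/

noncomputable section

open Bundle Set Filter Function
open scoped Manifold Topology

-- summit = problem name (D-0017)
set_option linter.dupNamespace false

namespace Summit.FinalStateConjecture.FinalStateConjecture.Theorems.ErgoregionBombModT

open Literature.Geometry.Lorentzian

section Evanescent

variable {𝓑 : StationaryAFBlackHole.{0}} [𝓑.metric.HasLeviCivita]

/-- **A critical point of `g(T,T)` is a hovering light point.**  If `d(g(T,T))(p) = 0` then
`∇_T T (p) = 0`: for every `Y₀ ∈ T_p M`, `2 g(Y₀, ∇_T T) = -Y₀ g(T,T) = 0`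
(`IsKillingField.two_mul_val_leviCivita_self_apply_self`), and `g_p` is non-degenerate.
O'Neill 1983, Ch. 9, Prop. 9.25. [cite: ONeill1983, Ch. 9, Prop. 9.25] -/
theorem leviCivita_killing_self_eq_zero_of_mfderiv_eq_zero {p : 𝓑.carrier}
    (hd : mfderiv (𝓡 4) 𝓘(ℝ, ℝ) (fun y ↦ 𝓑.metric.val y (𝓑.killing y) (𝓑.killing y)) p = 0) :
    𝓑.metric.leviCivita 𝓑.killing p (𝓑.killing p) = 0 := by
  have hK := 𝓑.isStationaryKilling.isKillingField
  refine 𝓑.metric.nondegenerate p _ fun Y₀ ↦ ?_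
  have h := hK.two_mul_val_leviCivita_self_apply_self p Y₀
  have h0 : mvfderiv (𝓡 4) (fun y ↦ 𝓑.metric.val y (𝓑.killing y) (𝓑.killing y)) p Y₀ = 0 := by
    change mfderiv (𝓡 4) 𝓘(ℝ, ℝ) (fun y ↦ 𝓑.metric.val y (𝓑.killing y) (𝓑.killing y)) p Y₀ = 0
    rw [hd]; rfl
  rw [h0, neg_zero] at h
  rw [𝓑.metric.symm p]
  linarith

/-- **A local maximum of `g(T,T)` is a hovering light point** (Fermat's theorem on the manifold
without boundary `M`, `IsLocalMax.isMCriticalPt`, then the previous lemma).  Milnor 1963, §2;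
O'Neill 1983, Ch. 9, Prop. 9.25. [cite: ONeill1983, Ch. 9, Prop. 9.25] -/
theorem leviCivita_killing_self_eq_zero_of_isLocalMax {p : 𝓑.carrier}
    (hmax : IsLocalMax (fun y ↦ 𝓑.metric.val y (𝓑.killing y) (𝓑.killing y)) p) :
    𝓑.metric.leviCivita 𝓑.killing p (𝓑.killing p) = 0 :=
  leviCivita_killing_self_eq_zero_of_mfderiv_eq_zero
    (Literature.Topology.FourManifolds.IsLocalMax.isMCriticalPt (I := 𝓡 4) hmax)

/-- **On a hole without ergoregion every null point of `T` in the d.o.c. is a hovering light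
point.**  If `g(T,T) ≤ 0` on `⟨⟨M_ext⟩⟩` (the stationary field is causal on the whole domain of
outer communications) and `g(T,T)(p) = 0` at some `p ∈ ⟨⟨M_ext⟩⟩`, then `p` is a local maximum of
`g(T,T)` (the d.o.c. is open), hence `∇_T T (p) = 0`.  O'Neill 1983, Ch. 9, Prop. 9.25.
[cite: ONeill1983, Ch. 9, Prop. 9.25] -/
theorem leviCivita_killing_self_eq_zero_of_causal_of_null
    (hcausal : ∀ x ∈ 𝓑.doc, 𝓑.metric.val x (𝓑.killing x) (𝓑.killing x) ≤ 0)
    {p : 𝓑.carrier} (hp : p ∈ 𝓑.doc) (hnull : 𝓑.metric.val p (𝓑.killing p) (𝓑.killing p) = 0) :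
    𝓑.metric.leviCivita 𝓑.killing p (𝓑.killing p) = 0 := by
  have hopen : IsOpen 𝓑.doc :=
    𝓑.isOpen_doc LorentzianMetric.isOpen_chronologicalFuture_holds_of_boundaryless
      LorentzianMetric.isOpen_chronologicalPast_holds_of_boundaryless
  refine leviCivita_killing_self_eq_zero_of_isLocalMax ?_
  filter_upwards [hopen.mem_nhds hp] with y hy
  rw [hnull]
  exact hcausal y hy

/-- **A hole without ergoregion whose stationary field is null somewhere in the d.o.c. carries a
zero-energy null geodesic trapped modulo the flow** — the `T`-orbit through the null point, a
complete null geodesic of hovering light points (`hasZeroEnergyRayTrappedModFlow_of_hoveringLightPoint`,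
p138761): the EVANESCENT species of the antecedent of `ErgoregionBombModT` (an evanescent
ergosurface inside the d.o.c., Eperon–Reall–Santos 2016 / Keir 2018). [cite: IonescuKlainerman2015, §4] -/
theorem hasZeroEnergyRayTrappedModFlow_of_causal_of_null
    (hT0 : ∀ p ∈ 𝓑.doc, 𝓑.killing p ≠ 0)
    (hcausal : ∀ x ∈ 𝓑.doc, 𝓑.metric.val x (𝓑.killing x) (𝓑.killing x) ≤ 0)
    {p : 𝓑.carrier} (hp : p ∈ 𝓑.doc) (hnull : 𝓑.metric.val p (𝓑.killing p) (𝓑.killing p) = 0) :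
    𝓑.HasZeroEnergyRayTrappedModFlow :=
  hasZeroEnergyRayTrappedModFlow_of_hoveringLightPoint hT0 hp hnull
    (leviCivita_killing_self_eq_zero_of_causal_of_null hcausal hp hnull)

end Evanescent

/-! ### Closed forms (registered certificates of crux stmt-FinalStateConjecture-17838) -/

/-- **The evanescent species inhabits the antecedent** (closed `∀`-form of
`hasZeroEnergyRayTrappedModFlow_of_causal_of_null`; registered certificate
`ergoregionFreeNullPoint_inhabits_antecedent` of crux stmt-FinalStateConjecture-17838 — a
certificate, not an obligation of the skeleton): a presentation with `T ≠ 0` and `g(T,T) ≤ 0` on its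
d.o.c. and `g(T,T)(p) = 0` at one `p ∈ ⟨⟨M_ext⟩⟩` has a maximal zero-energy null geodesic trapped
modulo the flow. [cite: IonescuKlainerman2015, §4] -/
theorem ergoregionFreeNullPoint_inhabits_antecedent :
    ∀ (𝓑 : Literature.Geometry.Lorentzian.StationaryAFBlackHole.{0}) [𝓑.metric.HasLeviCivita], (∀ p ∈ 𝓑.doc, 𝓑.killing p ≠ 0) → (∀ x ∈ 𝓑.doc, 𝓑.metric.val x (𝓑.killing x) (𝓑.killing x) ≤ 0) → ∀ p ∈ 𝓑.doc, 𝓑.metric.val p (𝓑.killing p) (𝓑.killing p) = 0 → 𝓑.HasZeroEnergyRayTrappedModFlow :=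
  fun _ _ hT0 hcausal _ hp hnull ↦ hasZeroEnergyRayTrappedModFlow_of_causal_of_null hT0 hcausal hp hnull

/-- **`LightPointBomb` bombs holes without ergoregion.**  From the registered stub
`stub_lightPointBomb` of line `killing-light-points` (hypothesis `hLP`, body VERBATIM: in the
telescope, a Killing light point `p ∈ ⟨⟨M_ext⟩⟩`, `g(T,T)(p) = 0`, `∇_T T = κ T`, forces the growing
Killing-mode pair) it follows that EVERY telescope hole whose stationary field is causal on the
whole d.o.c. (`g(T,T) ≤ 0` there: no ergoregion) and null at one point of the d.o.c. carries an
exponentially growing smooth Killing-mode pair — the null point is a hovering light point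
(`leviCivita_killing_self_eq_zero_of_causal_of_null`, `κ = 0`).  Since the crux implies
`LightPointBomb` (`lightPointBomb_of_ergoregionBombModT`, p139708), this is a consequence of
`ErgoregionBombModT` as typed; it runs against the `T`-energy monotonicity available exactly when
`T` is causal on the exterior (Kay–Wald; Dafermos–Rodnianski arXiv:0811.0354 §7), which is why the
lead recommends restating the crux to its off-wall half.  Registered certificate
`bomb_of_causal_of_null_of_lightPointBomb` of crux stmt-FinalStateConjecture-17838.
[cite: IonescuKlainerman2015, §4] -/
theorem bomb_of_causal_of_null_of_lightPointBomb :
    (∀ (𝓑 : Literature.Geometry.Lorentzian.StationaryAFBlackHole.{0}) [𝓑.metric.HasLeviCivita] [Literature.Geometry.Lorentzian.Kerr.Facts], 𝓑.metric.toPseudoRiemannianMetric.IsRicciFlat → 𝓑.IsIPlusRegular → (∀ p : 𝓑.carrier, p ∈ 𝓑.metric.chronologicalFuture 𝓑.timeOrientation 𝓑.Mext) → (∀ p ∈ 𝓑.doc, 𝓑.killing p ≠ 0) → SimplyConnectedSpace 𝓑.doc → ∀ (U : Set 𝓑.carrier) (K : Π x : 𝓑.carrier, TangentSpace (𝓡 4)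 x), IsOpen U → 𝓑.horizon ⊆ U → IsConnected 𝓑.horizon → ContMDiffOn (𝓡 4) ((𝓡 4).prod 𝓘(ℝ, Literature.Geometry.Lorentzian.E4)) ((⊤ : ℕ∞) : WithTop ℕ∞) (fun x ↦ (Bundle.TotalSpace.mk' Literature.Geometry.Lorentzian.E4 x (K x) : TangentBundle (𝓡 4) 𝓑.carrier)) U → (∀ x ∈ U, ∀ v w : TangentSpace (𝓡 4) x, 𝓑.metric.val x (𝓑.metric.leviCivita K x v) w + 𝓑.metric.val x v (𝓑.metric.leviCivita K x w) = 0) → (∀ x ∈ U, VectorField.mlieBracket (𝓡 4) 𝓑.killing K x = 0) → (∀ p ∈ 𝓑.horizon, K p ≠ 0) → (∀ γ : ℝ → 𝓑.carrier, IsMIntegralCurve γ K → γ 0 ∈ 𝓑.horizon → ∀ t, γ t ∈ 𝓑.horizon) → (∀ x ∈ U ∩ 𝓑.doc, 𝓑.metric.val x (K x) (K x) < 0) → (∃ S₀ : Set 𝓑.carrier, IsCompact S₀ ∧ S₀ ⊆ 𝓑.doc ∧ ∀ y ∈ 𝓑.doc, 0 ≤ 𝓑.metric.val y (𝓑.killing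 y) (𝓑.killing y) → y ∉ U → y ∈ Literature.Geometry.Lorentzian.stationaryOrbit 𝓑.killing S₀) → ∀ p ∈ 𝓑.doc, 𝓑.metric.val p (𝓑.killing p) (𝓑.killing p) = 0 → ∀ κ : ℝ, 𝓑.metric.leviCivita 𝓑.killing p (𝓑.killing p) = κ • 𝓑.killing p → ∃ (ν ω : ℝ) (ψ χ : 𝓑.carrier → ℝ), 0 < ν ∧ (∃ U : Set 𝓑.carrier, IsOpen U ∧ 𝓑.doc ∪ 𝓑.horizon ⊆ U ∧ ContMDiffOn (𝓡 4) 𝓘(ℝ, ℝ) ((⊤ : ℕ∞) : WithTop ℕ∞) ψ U ∧ ContMDiffOn (𝓡 4) 𝓘(ℝ, ℝ) ((⊤ : ℕ∞) : WithTop ℕ∞) χ U) ∧ (∀ x ∈ 𝓑.doc, 𝓑.metric.dalembertian ψ x = 0 ∧ 𝓑.metric.dalembertian χ x = 0) ∧ (∀ x ∈ 𝓑.doc, mfderiv (𝓡 4) 𝓘(ℝ, ℝ) ψ x (𝓑.killing x) = ν * ψ x - ω * χ x ∧ mfderiv (𝓡 4) 𝓘(ℝ, ℝ) χ x (𝓑.killing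 x) = ω * ψ x + ν * χ x) ∧ (∃ C : ℝ, ∀ x ∈ 𝓑.doc ∩ 𝓑.metric.chronologicalPast 𝓑.timeOrientation (𝓑.embed '' 𝓑.e.far (𝓑.e.R + 1)), |ψ x| ≤ C ∧ |χ x| ≤ C) ∧ ∃ x ∈ 𝓑.doc, ψ x ≠ 0 ∨ χ x ≠ 0) → ∀ (𝓑 : Literature.Geometry.Lorentzian.StationaryAFBlackHole.{0}) [𝓑.metric.HasLeviCivita] [Literature.Geometry.Lorentzian.Kerr.Facts], 𝓑.metric.toPseudoRiemannianMetric.IsRicciFlat → 𝓑.IsIPlusRegular → (∀ p : 𝓑.carrier, p ∈ 𝓑.metric.chronologicalFuture 𝓑.timeOrientation 𝓑.Mext) → (∀ p ∈ 𝓑.doc, 𝓑.killing p ≠ 0) → SimplyConnectedSpace 𝓑.doc → ∀ (U : Set 𝓑.carrier) (K : Π x : 𝓑.carrier, TangentSpace (𝓡 4) x), IsOpen U → 𝓑.horizon ⊆ U → IsConnected 𝓑.horizon → ContMDiffOn (𝓡 4) ((𝓡 4).prod 𝓘(ℝ, Literature.Geometry.Lorentzian.E4)) ((⊤ : ℕ∞)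 : WithTop ℕ∞) (fun x ↦ (Bundle.TotalSpace.mk' Literature.Geometry.Lorentzian.E4 x (K x) : TangentBundle (𝓡 4) 𝓑.carrier)) U → (∀ x ∈ U, ∀ v w : TangentSpace (𝓡 4) x, 𝓑.metric.val x (𝓑.metric.leviCivita K x v) w + 𝓑.metric.val x v (𝓑.metric.leviCivita K x w) = 0) → (∀ x ∈ U, VectorField.mlieBracket (𝓡 4) 𝓑.killing K x = 0) → (∀ p ∈ 𝓑.horizon, K p ≠ 0) → (∀ γ : ℝ → 𝓑.carrier, IsMIntegralCurve γ K → γ 0 ∈ 𝓑.horizon → ∀ t, γ t ∈ 𝓑.horizon) → (∀ x ∈ U ∩ 𝓑.doc, 𝓑.metric.val x (K x) (K x) < 0) → (∃ S₀ : Set 𝓑.carrier, IsCompact S₀ ∧ S₀ ⊆ 𝓑.doc ∧ ∀ y ∈ 𝓑.doc, 0 ≤ 𝓑.metric.val y (𝓑.killing y) (𝓑.killing y) → y ∉ U → y ∈ Literature.Geometry.Lorentzian.stationaryOrbit 𝓑.killing S₀) → (∀ x ∈ 𝓑.doc, 𝓑.metric.val x (𝓑.killing x) (𝓑.killing x) ≤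 0) → ∀ p ∈ 𝓑.doc, 𝓑.metric.val p (𝓑.killing p) (𝓑.killing p) = 0 → ∃ (ν ω : ℝ) (ψ χ : 𝓑.carrier → ℝ), 0 < ν ∧ (∃ U : Set 𝓑.carrier, IsOpen U ∧ 𝓑.doc ∪ 𝓑.horizon ⊆ U ∧ ContMDiffOn (𝓡 4) 𝓘(ℝ, ℝ) ((⊤ : ℕ∞) : WithTop ℕ∞) ψ U ∧ ContMDiffOn (𝓡 4) 𝓘(ℝ, ℝ) ((⊤ : ℕ∞) : WithTop ℕ∞) χ U) ∧ (∀ x ∈ 𝓑.doc, 𝓑.metric.dalembertian ψ x = 0 ∧ 𝓑.metric.dalembertian χ x = 0) ∧ (∀ x ∈ 𝓑.doc, mfderiv (𝓡 4) 𝓘(ℝ, ℝ) ψ x (𝓑.killing x) = ν * ψ x - ω * χ x ∧ mfderiv (𝓡 4) 𝓘(ℝ, ℝ) χ x (𝓑.killing x) = ω * ψ x + ν * χ x) ∧ (∃ C : ℝ, ∀ x ∈ 𝓑.doc ∩ 𝓑.metric.chronologicalPast 𝓑.timeOrientation (𝓑.embed '' 𝓑.e.far (𝓑.e.R + 1)),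 |ψ x| ≤ C ∧ |χ x| ≤ C) ∧ ∃ x ∈ 𝓑.doc, ψ x ≠ 0 ∨ χ x ≠ 0 := by
  intro hLP 𝓑 _ _ hRic hReg hpres hT0 hsc U K hU hHU hconn hKs hKill hcomm hK0 hKtan hKtime hbelt hcausal p hp hnull
  exact hLP 𝓑 hRic hReg hpres hT0 hsc U K hU hHU hconn hKs hKill hcomm hK0 hKtan hKtime hbelt p hp hnull 0
    (by rw [zero_smul]; exact leviCivita_killing_self_eq_zero_of_causal_of_null hcausal hp hnull)

end Summit.FinalStateConjecture.FinalStateConjecture.Theorems.ErgoregionBombModT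

end
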